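import Mathlib
import Summits.Ventures.HodgeRepro2.T5RamificationIndexUniformizer

/-!
# T5ContinuousValuationExtension — a continuous ring homomorphism between valued fields is
valuation-compatible; Mathlib's `Valuation.HasExtension` for the adic completions

Blind cell pub-hodge-repro2, seat p4 (Tier-5 Lean support, annex growth only).
Declaration per README §8(d): uses an L-value-free non-vanishing device: NO.

The (A6)/(A13) kernel chains of this seat (rows 63–71) work with a DVR pair `A ⊆ B` in Mathlib's
AKLB setting, `A` and `B` the valuation rings of the two valuations. On Mathlib's concrete local
fields `Kv := v.adicCompletion K` the `A`-side is in Mathlib (`adicCompletionIntegers K v` is a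
DVR with `Valued.v.Integers`); the `B`-side needs the algebra map `Kv → Lw` to be compatible with
the two valuations. Mathlib's `Module.Finite Kv Lw` section assumes only `[Algebra Kv Lw]
[ContinuousSMul Kv Lw]` and does not derive that compatibility. This file proves it in general:

* §1 — a CONTINUOUS ring homomorphism `φ : K →+* L` between valued fields with `MulArchimedean`
  value groups satisfies `v x < 1 → w (φ x) < 1` (powers of `x` tend to `0`); if the source
  valuation is non-trivial the converse holds too (`val_lt_one_iff_of_continuous`), hence
  `v.IsEquiv (w.comap φ)` (`isEquiv_comap_of_continuous`) — Mathlib's `Valuation.HasExtension`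
  for a continuous algebra (`hasExtension_of_continuousSMul`).
* §2 — for the adic completions of fraction fields of Dedekind domains this gives an INSTANCE
  `HasExtension`, hence (Mathlib) the algebra `adicCompletionIntegers K v → adicCompletionIntegers
  L w`, its scalar towers, `IsLocalHom`, `LiesOver` of the maximal ideals, and the uniformiser
  relation `algebraMap ϖ = u * π ^ e` with `e` = Mathlib's `ramificationIdx'` — the hypothesis of
  rows 65/68; the residual of the full AKLB instantiation (`IsIntegralClosure`) is reduced to the
  single hypothesis `Algebra.IsIntegral (adicCompletionIntegers K v) (adicCompletionIntegers L w)`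
  (`isIntegralClosure_of_isIntegral`).

Nothing here is asserted about the Tier-5 datum; what stays prose is the existence of the
continuous algebra `Kv → Lw` for `w ∣ v` (assumed by Mathlib's own section as well) and the
integrality `Algebra.IsIntegral O_Kv O_Lw` (the completeness input proper).
-/

namespace Summit.Ventures.HodgeRepro2.T5ContinuousValuationExtension

open Filter Topology
open scoped WithZero

/-! ## §1 Continuous ring homomorphisms between valued fields are valuation-compatible -/

section General

variable {K L Γ₀ Γ₁ : Type*} [Field K] [Field L]
  [LinearOrderedCommGroupWithZero Γ₀] [LinearOrderedCommGroupWithZero Γ₁]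
  [Valued K Γ₀] [Valued L Γ₁] [MulArchimedean Γ₀] [MulArchimedean Γ₁]

omit [MulArchimedean Γ₁] in
/-- `v x < 1 → w (φ x) < 1` for a continuous ring homomorphism `φ`: the powers `x ^ n` tend to
`0`, so do their images `φ x ^ n`, while `{y | w y < 1}` is a neighbourhood of `0` containing no
power of an element of valuation `≥ 1`. -/
theorem val_lt_one_of_continuous (φ : K →+* L) (hφ : Continuous φ) {x : K}
    (hx : Valued.v x < 1) : Valued.v (φ x) < 1 := by
  by_contra h
  rw [not_lt] at h
  have h1 : Tendsto (fun n : ℕ => φ x ^ n) atTop (𝓝 (0 : L)) := by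
    have h2 := (hφ.tendsto (0 : K)).comp (Valued.tendsto_zero_pow_of_v_lt_one hx)
    rw [map_zero] at h2
    refine h2.congr fun n => ?_
    simp [Function.comp, map_pow]
  have hU : {y : L | Valued.v.restrict y < 1} ∈ 𝓝 (0 : L) :=
    Valued.mem_nhds_zero.mpr ⟨1, fun y hy => by simpa using hy⟩
  obtain ⟨N, hN⟩ := Filter.eventually_atTop.mp (h1.eventually hU)
  have hmem := hN N le_rfl
  rw [Valuation.restrict_lt_one_iff, map_pow] at hmem
  exact absurd hmem (not_lt.mpr (one_le_pow₀ h))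

omit [MulArchimedean Γ₁] in
/-- `1 < v x → 1 < w (φ x)` (the previous lemma applied to `x⁻¹`). -/
theorem one_lt_val_of_continuous (φ : K →+* L) (hφ : Continuous φ) {x : K}
    (hx : 1 < Valued.v x) : 1 < Valued.v (φ x) := by
  have hx0 : x ≠ 0 := by rintro rfl; simp at hx
  have hpos : 0 < Valued.v x := zero_lt_iff.mpr ((Valuation.ne_zero_iff _).mpr hx0)
  have hinv : Valued.v x⁻¹ < 1 := by rw [map_inv₀]; exact (inv_lt_one₀ hpos).mpr hx
  have h := val_lt_one_of_continuous φ hφ hinv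
  rw [map_inv₀, map_inv₀] at h
  have hφpos : 0 < Valued.v (φ x) :=
    zero_lt_iff.mpr ((Valuation.ne_zero_iff _).mpr ((map_ne_zero φ).mpr hx0))
  exact (inv_lt_one₀ hφpos).mp h

/-- The converse `w (φ x) < 1 → v x < 1`, given a non-trivial source valuation (some `x₀` with
`0 < v x₀ < 1`): if `v x = 1` then `1 < v (x ^ n / x₀)` for every `n`, hence
`w (φ x₀) < w (φ x) ^ n` for every `n` — impossible when `w (φ x) < 1` (`exists_pow_lt₀`). -/
theorem val_lt_one_iff_of_continuous (φ : K →+* L) (hφ : Continuous φ)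
    (hK : ∃ x₀ : K, 0 < Valued.v x₀ ∧ Valued.v x₀ < 1) (x : K) :
    Valued.v (φ x) < 1 ↔ Valued.v x < 1 := by
  refine ⟨fun h => ?_, val_lt_one_of_continuous φ hφ⟩
  by_contra hx
  rcases (not_lt.mp hx).lt_or_eq with hgt | heq
  · exact absurd h (not_lt.mpr (one_lt_val_of_continuous φ hφ hgt).le)
  · obtain ⟨x₀, h0, h1⟩ := hK
    have hx₀0 : x₀ ≠ 0 := fun h' => by simp [h'] at h0
    have hφx₀ : 0 < Valued.v (φ x₀) :=
      zero_lt_iff.mpr ((Valuation.ne_zero_iff _).mpr ((map_ne_zero φ).mpr hx₀0))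
    have key : ∀ n : ℕ, Valued.v (φ x₀) < Valued.v (φ x) ^ n := fun n => by
      have h2 : 1 < Valued.v (x ^ n / x₀) := by
        rw [map_div₀, map_pow, ← heq, one_pow]
        exact (one_lt_div₀ h0).mpr h1
      have h3 := one_lt_val_of_continuous φ hφ h2
      rw [map_div₀, map_div₀, map_pow, map_pow, one_lt_div₀ hφx₀] at h3
      exact h3
    obtain ⟨n, hn⟩ := exists_pow_lt₀ h (Units.mk0 _ hφx₀.ne')
    rw [Units.val_mk0] at hn
    exact absurd (key n) (not_lt.mpr hn.le)

/-- The source valuation is equivalent to the pull-back of the target valuation along a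
continuous ring homomorphism (non-trivial source valuation). -/
theorem isEquiv_comap_of_continuous (φ : K →+* L) (hφ : Continuous φ)
    (hK : ∃ x₀ : K, 0 < Valued.v x₀ ∧ Valued.v x₀ < 1) :
    (Valued.v : Valuation K Γ₀).IsEquiv ((Valued.v : Valuation L Γ₁).comap φ) :=
  Valuation.isEquiv_iff_val_lt_one.mpr fun {x} =>
    ⟨fun h => by rw [Valuation.comap_apply]; exact val_lt_one_of_continuous φ hφ h,
     fun h => by
      rw [Valuation.comap_apply] at h
      exact (val_lt_one_iff_of_continuous φ hφ hK x).mp h⟩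

/-- `w (φ x) ≤ 1 ↔ v x ≤ 1` (non-trivial source valuation). Without non-triviality this fails:
`ℚ` with the trivial valuation (discrete topology) embeds continuously into `ℚ_p`, and
`v (1/p) = 1` while `w (1/p) > 1`. -/
theorem val_le_one_iff_of_continuous (φ : K →+* L) (hφ : Continuous φ)
    (hK : ∃ x₀ : K, 0 < Valued.v x₀ ∧ Valued.v x₀ < 1) (x : K) :
    Valued.v (φ x) ≤ 1 ↔ Valued.v x ≤ 1 := by
  have h := Valuation.isEquiv_iff_val_le_one.mp (isEquiv_comap_of_continuous φ hφ hK) (x := x)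
  rw [Valuation.comap_apply] at h
  exact h.symm

/-- `w (φ x) = 1 ↔ v x = 1` (non-trivial source valuation). -/
theorem val_eq_one_iff_of_continuous (φ : K →+* L) (hφ : Continuous φ)
    (hK : ∃ x₀ : K, 0 < Valued.v x₀ ∧ Valued.v x₀ < 1) (x : K) :
    Valued.v (φ x) = 1 ↔ Valued.v x = 1 := by
  have h := Valuation.isEquiv_iff_val_eq_one.mp (isEquiv_comap_of_continuous φ hφ hK) (x := x)
  rw [Valuation.comap_apply] at h
  exact h.symm

/-- Mathlib's `Valuation.HasExtension` for a continuous algebra over a non-trivially valued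
field. -/
theorem hasExtension_of_continuousSMul [Algebra K L] [ContinuousSMul K L]
    (hK : ∃ x₀ : K, 0 < Valued.v x₀ ∧ Valued.v x₀ < 1) :
    (Valued.v : Valuation K Γ₀).HasExtension (Valued.v : Valuation L Γ₁) :=
  ⟨isEquiv_comap_of_continuous (algebraMap K L) (continuous_algebraMap K L) hK⟩

end General

/-- The non-triviality hypothesis from an element of valuation `exp (-1)` (a uniformiser). -/
theorem exists_pos_lt_one_of_exists_val_eq_exp_neg_one {K : Type*} [Field K] [Valued K ℤᵐ⁰]
    (h : ∃ ϖ : K, Valued.v ϖ = WithZero.exp (-1)) :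
    ∃ x₀ : K, 0 < Valued.v x₀ ∧ Valued.v x₀ < 1 := by
  obtain ⟨ϖ, hϖ⟩ := h
  refine ⟨ϖ, ?_, ?_⟩
  · rw [hϖ]; exact zero_lt_iff.mpr WithZero.exp_ne_zero
  · rw [hϖ, ← WithZero.exp_zero, WithZero.exp_lt_exp]; norm_num

/-! ## §2 Mathlib's adic completions: `HasExtension`, the algebra of the rings of integers, the
uniformiser relation, and the integral-closure residual -/

section AdicCompletion

open IsDedekindDomain HeightOneSpectrum

variable {R : Type*} [CommRing R] [IsDedekindDomain R] {K : Type*} [Field K] [Algebra R K]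
  [IsFractionRing R K]
variable {S : Type*} [CommRing S] [IsDedekindDomain S] {L : Type*} [Field L] [Algebra S L]
  [IsFractionRing S L]

/-- The valuation of `v.adicCompletion K` is non-trivial (it is onto `ℤᵐ⁰`). -/
theorem exists_pos_lt_one_adicCompletion (v : HeightOneSpectrum R) :
    ∃ x₀ : v.adicCompletion K, 0 < Valued.v x₀ ∧ Valued.v x₀ < 1 :=
  exists_pos_lt_one_of_exists_val_eq_exp_neg_one
    (valuedAdicCompletion_surjective K v (WithZero.exp (-1)))

variable {v : HeightOneSpectrum R} {w : HeightOneSpectrum S}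
  [Algebra (v.adicCompletion K) (w.adicCompletion L)]
  [ContinuousSMul (v.adicCompletion K) (w.adicCompletion L)]

/-- A continuous algebra `v.adicCompletion K → w.adicCompletion L` is a valuation extension in
Mathlib's sense. -/
instance hasExtension_adicCompletion :
    (Valued.v : Valuation (v.adicCompletion K) ℤᵐ⁰).HasExtension
      (Valued.v : Valuation (w.adicCompletion L) ℤᵐ⁰) :=
  hasExtension_of_continuousSMul (exists_pos_lt_one_adicCompletion v)

/-- `w (algebraMap x) < 1 ↔ v x < 1` for the adic completions. -/
theorem val_algebraMap_lt_one_iff (x : v.adicCompletion K) :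
    Valued.v (algebraMap (v.adicCompletion K) (w.adicCompletion L) x) < 1 ↔ Valued.v x < 1 :=
  Valuation.HasExtension.val_map_lt_one_iff _ _ x

/-- `w (algebraMap x) ≤ 1 ↔ v x ≤ 1` for the adic completions. -/
theorem val_algebraMap_le_one_iff (x : v.adicCompletion K) :
    Valued.v (algebraMap (v.adicCompletion K) (w.adicCompletion L) x) ≤ 1 ↔ Valued.v x ≤ 1 :=
  Valuation.HasExtension.val_map_le_one_iff _ _ x

/-- `w (algebraMap x) = 1 ↔ v x = 1` for the adic completions. -/
theorem val_algebraMap_eq_one_iff (x : v.adicCompletion K) :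
    Valued.v (algebraMap (v.adicCompletion K) (w.adicCompletion L) x) = 1 ↔ Valued.v x = 1 :=
  Valuation.HasExtension.val_map_eq_one_iff _ _ x

/-- The ring of integers of `Kv` maps into the ring of integers of `Lw`. -/
theorem algebraMap_mem_adicCompletionIntegers (x : v.adicCompletionIntegers K) :
    algebraMap (v.adicCompletion K) (w.adicCompletion L) x ∈ w.adicCompletionIntegers L :=
  Valuation.HasExtension.algebraMap_mem_valuationSubring _ _ x

/-- The algebra `O_Kv → O_Lw` (Mathlib's `instAlgebra_valuationSubring` through
`hasExtension_adicCompletion`). -/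
noncomputable instance algebra_adicCompletionIntegers :
    Algebra (v.adicCompletionIntegers K) (w.adicCompletionIntegers L) :=
  inferInstanceAs (Algebra (Valued.v : Valuation (v.adicCompletion K) ℤᵐ⁰).valuationSubring
    (Valued.v : Valuation (w.adicCompletion L) ℤᵐ⁰).valuationSubring)

/-- The algebra map `O_Kv → O_Lw` is the restriction of `algebraMap Kv Lw` (definitional). -/
@[simp]
theorem coe_algebraMap_adicCompletionIntegers (x : v.adicCompletionIntegers K) :
    (algebraMap (v.adicCompletionIntegers K) (w.adicCompletionIntegers L) x : w.adicCompletion L) =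
      algebraMap (v.adicCompletion K) (w.adicCompletion L) (x : v.adicCompletion K) :=
  rfl

/-- The scalar tower `O_Kv → O_Lw → Lw`. -/
instance isScalarTower_adicCompletionIntegers :
    IsScalarTower (v.adicCompletionIntegers K) (w.adicCompletionIntegers L) (w.adicCompletion L) :=
  inferInstanceAs (IsScalarTower (Valued.v : Valuation (v.adicCompletion K) ℤᵐ⁰).valuationSubring
    (Valued.v : Valuation (w.adicCompletion L) ℤᵐ⁰).valuationSubring (w.adicCompletion L))

/-- The scalar tower `O_Kv → Kv → Lw`. -/
instance isScalarTower_adicCompletionIntegers' :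
    IsScalarTower (v.adicCompletionIntegers K) (v.adicCompletion K) (w.adicCompletion L) :=
  inferInstanceAs (IsScalarTower (Valued.v : Valuation (v.adicCompletion K) ℤᵐ⁰).valuationSubring
    (v.adicCompletion K) (w.adicCompletion L))

/-- `O_Kv → O_Lw` is a local homomorphism (Mathlib, through `HasExtension`). -/
instance isLocalHom_algebraMap_adicCompletionIntegers :
    IsLocalHom (algebraMap (v.adicCompletionIntegers K) (w.adicCompletionIntegers L)) :=
  inferInstanceAs (IsLocalHom (algebraMap
    (Valued.v : Valuation (v.adicCompletion K) ℤᵐ⁰).valuationSubring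
    (Valued.v : Valuation (w.adicCompletion L) ℤᵐ⁰).valuationSubring))

/-- The maximal ideal of `O_Lw` lies over the maximal ideal of `O_Kv` (Mathlib, through
`HasExtension`). -/
instance liesOver_maximalIdeal_adicCompletionIntegers :
    Ideal.LiesOver (IsLocalRing.maximalIdeal (w.adicCompletionIntegers L))
      (IsLocalRing.maximalIdeal (v.adicCompletionIntegers K)) :=
  inferInstanceAs (Ideal.LiesOver
    (IsLocalRing.maximalIdeal (Valued.v : Valuation (w.adicCompletion L) ℤᵐ⁰).valuationSubring)
    (IsLocalRing.maximalIdeal (Valued.v : Valuation (v.adicCompletion K) ℤᵐ⁰).valuationSubring))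

/-- `O_Kv → O_Lw` is injective (a field homomorphism restricted to subrings). -/
theorem algebraMap_adicCompletionIntegers_injective :
    Function.Injective (algebraMap (v.adicCompletionIntegers K) (w.adicCompletionIntegers L)) :=
  fun _ _ h => Subtype.ext ((algebraMap (v.adicCompletion K) (w.adicCompletion L)).injective
    (congrArg Subtype.val h))

/-- A non-zero element of `O_Kv` stays non-zero in `O_Lw` (row 68's hypothesis `algebraMap ϖ ≠ 0`). -/
theorem algebraMap_adicCompletionIntegers_ne_zero {ϖ : v.adicCompletionIntegers K} (hϖ : ϖ ≠ 0) :
    algebraMap (v.adicCompletionIntegers K) (w.adicCompletionIntegers L) ϖ ≠ 0 :=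
  fun h => hϖ (algebraMap_adicCompletionIntegers_injective (by rw [h, map_zero]))

/-- Rows 65/68's hypothesis «`algebraMap ϖ = u * π ^ e`» for the concrete pair, with `e` =
Mathlib's `ramificationIdx'` (p395019 applied to the DVR `O_Lw`). -/
theorem exists_unit_algebraMap_eq_mul_pow (ϖ : v.adicCompletionIntegers K) (hϖ : ϖ ≠ 0)
    (π : w.adicCompletionIntegers L) (hπ : Irreducible π) :
    ∃ u : (w.adicCompletionIntegers L)ˣ,
      algebraMap (v.adicCompletionIntegers K) (w.adicCompletionIntegers L) ϖ =
        u * π ^ (Ideal.span {ϖ}).ramificationIdx' (Ideal.span {π}) :=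
  T5RamificationIndexUniformizer.exists_unit_algebraMap_eq_mul_pow_ramificationIdx' ϖ
    (algebraMap_adicCompletionIntegers_ne_zero hϖ) π hπ

/-- The residual of the AKLB instantiation reduced to integrality: if `O_Lw` is integral over
`O_Kv`, it is the integral closure of `O_Kv` in `Lw` (valuation rings are integrally closed). -/
theorem isIntegralClosure_of_isIntegral
    [Algebra.IsIntegral (v.adicCompletionIntegers K) (w.adicCompletionIntegers L)] :
    IsIntegralClosure (w.adicCompletionIntegers L) (v.adicCompletionIntegers K)
      (w.adicCompletion L) :=
  IsIntegralClosure.of_isIntegrallyClosed _ _ _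

end AdicCompletion

end Summit.Ventures.HodgeRepro2.T5ContinuousValuationExtension
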